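import Summits.ABC.IUTFork.DAGC312a
import Summits.ABC.IUTFork.DAGC312g
import Summits.ABC.IUTFork.Cor312PinnedRegionsThreePins

/-!
# Branch C — layer certificate C312: the [IUTchIII] Cor. 3.12 layer of the cone, modulo S (rung LADDER-ABC:A2.C)

C layer-certificate C312 v0 — local scoreboard of the COUNTED theorem `layerC312_of_S`: S 1 · PIN 2 · FACT 0 · CONE 1 · READ 0 = 4
(the number of its `Prop`-valued explicit binders; data binders `F`, `Pc`, `ρ`, `qK` are not counted). Written by abc-iut-c312-2
(gen 4; the C312 chain / kernel-DAG-index lineage) per HOME/plan/C/ABC-OF-S-SPEC.md v0 §3 of abc-iut-plan g8 (C lead; director-abc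
05:19:55Z (C2); human rulings D-0067 / D-0077 / D-0078): "`Conditional/Layer<k>OfS.lean` … `LayerC312OfS.lean`: the layer's cone-node
`Prop`s that the apex path consumes, in DAG kernel-id order; nodes already discharged enter as proofs, the rest as the certificate's own
binders". S := `Cor312Vol.PilotKummerIndRelated` (Cor312PinnedRegionsThreePins.lean l.145).

THIS FILE PROVES NOTHING NEW AND ASSERTS NOTHING. It composes, BY NAME, landed pieces of the cell's tree.

THE C312 LAYER OF THE CONE. HOME/plan/COR312-CONE.tsv (abc-iut-plan, 793 member nodes @05:06Z) has exactly FOUR members of layer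
C312, all `landed`, none `discharged`: `IUTchIII:Thm3.11(i)` (kernel id `N_IUTchIII_Thm3_11_i`, DAGC312g: `Situation.PartI`),
`IUTchIII:Thm3.11(ii)` (`N_IUTchIII_Thm3_11_ii`: `LatticeSituation.PartII`), `IUTchIII:Thm3.11(iii)` (`N_IUTchIII_Thm3_11_iii`:
`FullSituation.PartIII`) and the root `IUTchIII:Cor3.12` (`N_IUTchIII_Cor3_12 X := X.Cor312` over the [IUTchIV] Thm-1.10 numbers,
DAGC312a; at the level of the Corollary's own verbatim setting: abc-iut-c312-7's `Cor312.Setting.Statement := negLogTheta ≠ ⊤ ∧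
↑negLogQ ≤ negLogTheta`, Cor312Statement.lean l.372). The other 90 DAG rows of layer C312 are NOT cone members (the cone is the backward
STATEMENT-citation closure; "Rmk nodes not followed"): the 21 PROOF-STEP nodes `IUTchIII:Cor3.12.pf(WLOG)`, `(i)`–`(xii)`, `(xi-a)`–`(xi-h)`
(kernel ids `N_IUTchIII_Cor3_12_pf_<s>`, DAGC312b), the Remarks 3.11.1–3.11.4 / 3.12.1–3.12.4 (35 rows, 22 discharged, indexed in DAGC312x
etc.), and the 34 `Fork:*` skeleton-file rows. They are therefore NOT conjuncts of the counted certificate; the proof-step nodes — this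
lineage's own chain — are certified SEPARATELY in the companion file `Conditional/LayerC312StepsOfS.lean` (`layerC312_steps_of_S`,
`layerC312_step_nodes_of_S`), clearly labelled, with their own (uncounted) side binders, so that nothing the layer holds is left
uncertified and nothing off the apex path is counted. CO-IMPORT NOTE (abc-iut-w5-d104 sentinel, breaker B1): THIS file imports only
NEUTRAL modules (DAGC312a, DAGC312g, Cor312PinnedRegionsThreePins — the same side as `Conditional/AbcOfS.lean`); the companion imports
DAGC312p (A-side of B1, via Cor312TeamAChain) and must not be co-imported with a B-side module until B1 is repaired.

§1 `layerC312_of_S` (COUNTED). Binders: [S] `hS : PilotKummerIndRelated F.toLatticeSituation Pc ρ qK`; [PIN] `hPin : PinnedRegions3 …`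
(the Corollary's own three pins (pΘ) ∧ (pq′) ∧ (pL), statement p. 173 l. 46 – p. 174 l. 9 + Def. 3.8 (ii)), `hBridge : BridgeHyps Pc`
(abc-iut-c312-6: monotone log-volume, admissible possible images with finitely supported weights, nonempty hull-sets and Θ-regions,
`ThetaFinite` — proof of Cor. 3.12 p. 174 l. 50 – p. 175 l. 8); [FACT] none; [CONE] `hThm311 : DAG.N_IUTchIII_Thm3_11 F` — Theorem
3.11 AS A WHOLE as typed (`FullSituation.Statement := PartI ∧ PartII ∧ PartIII`, abc-iut-c312-1), the layer's one INPUT node: its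
three conjuncts ARE the three landed-not-discharged cone members, so they "enter as the certificate's own binder" (spec §3) — ONE
binder rather than three because the apex file `Conditional/AbcOfS.lean` (C-cert-1/2 v0) binds exactly `hThm311 : ∀ P, DAG.N_IUTchIII_Thm3_11
(F P)`; [READ] none at this level. Conclusion: the four cone members in DAG order — (i), (ii), (iii) by projection, and Cor. 3.12 as
typed (`Pc.Statement`) by PR-1's residual theorem `statement_of_thm311_of_pinned3_of_pilotKummerIndRelated` (p418935) BY NAME.
`layerC312_cor312_node_of_S` adds the two READ identifications of the apex file (`hΘ`, `hq`: the setting's `−|log(Θ)|` (when finite)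
and `−|log(q)|` ARE the curve's Thm-1.10 numbers) and concludes the root IN INDEX CURRENCY, `DAG.N_IUTchIII_Cor3_12 X` — so that
`AbcOfS` v1 may read `DAG.summit_of_cor312 V T A hInd (fun P => layerC312_cor312_node_of_S …)` with the same seven binders.

§2 = companion file `LayerC312StepsOfS.lean`: THE PROOF-STEP NODES MODULO S (NOT counted; the lineage's chain, DAGC312p Δ7). Under the readings of record `(lociReadingI F pending,
obsReadingA F pending Pc Dk)` nineteen of the twenty inferences are theorems (sixteen outright, three under named side data of the
instantiation) and the twentieth, (xi-f) — the node citing no locus — is EQUIVALENT to the Statement (`N_IUTchIII_Cor3_12_pf_xi_f_iff`);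
so S + pins + bridge + Thm 3.11 give the WHOLE twenty-node chain `DAG.N_IUTchIII_Cor3_12_pf` (`layerC312_steps_of_S`) and each of the 21
named step nodes (`layerC312_step_nodes_of_S`), given the side binders [SIDE] `hIndAdm`, `hIndVol`, `hMono` (coarse-space properties of
the line's data `F.D Pc.n`: admissibility invariance on the (Ind1)/(Ind2) generators, `LogvolInvariant`, monotonicity over ALL labels —
TEAM B rows B-2/B-4 discharge them for the real containers), `hNE` (nonempty strip isomorphisms, Def. 3.8 (ii)'s presupposition;
`Cor312Proof.hNE_satisfiable`) and `hqpos : Pc.AbsLogQPos` ("`|log(q)| > 0`", p. 174 l. 13; NECESSARY for (xi-d), abc-iut-c312-4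
`thetaFinite_of_comparableObjects`). `ThetaFinite` is `hBridge.finite`. Local count of §2 if it were counted: S 1 · PIN 2 · CONE 1 ·
SIDE 5 = 9.

HONEST FRAMING: this campaign LOCATES / CONDITIONALLY VERIFIES. Nothing here asserts that abc is proved or refuted, or takes a side on
[IUTchIII] Cor. 3.12 or on any author; S is an assumption label, not an endorsement; Theorem 3.11 enters as a NAMED HYPOTHESIS, never
asserted. typed ≠ proved; indexed ≠ endorsed; establishment = our kernel check. [claim: Mochizuki2012, status: disputed]
-/

noncomputable section

namespace Summit.ABC.IUTFork.Conditional

open Thm311 Cor312 Cor312Vol DAG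

variable {T : ThetaIndex}

/-! ## §1 The counted certificate: the four C312 cone members modulo S -/

/-- **`layerC312_of_S` — C layer certificate C312, v0 (local scoreboard 4 = S 1 · PIN 2 · FACT 0 · CONE 1 · READ 0).** For a full
situation `F` of [IUTchIII] Theorem 3.11, a verbatim Cor.-3.12 setting `Pc` over it, PR-1's region reading `ρ` and q-pilot Kummer datum
`qK`: IF [S] the residual `PilotKummerIndRelated` holds (tag S), [PIN] the three pins hold and the bridge hypotheses hold (tag PIN ×2),
and [CONE] Theorem 3.11 as typed holds for `F` (tag CONE, kernel id `N_IUTchIII_Thm3_11`, layer C312 — the layer's input node), THEN the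
four C312 members of the cone hold, in DAG order: Thm 3.11 (i), (ii), (iii) (kernel ids `N_IUTchIII_Thm3_11_i/_ii/_iii`, by projection —
they ARE the conjuncts of the input) and [IUTchIII] Cor. 3.12 AS TYPED at the setting (`Cor312.Setting.Statement`, by PR-1's
`statement_of_thm311_of_pinned3_of_pilotKummerIndRelated` BY NAME: typed Thm 3.11 supplies (ii) (b) `KummerB` for column `n`).
[claim: Mochizuki2012, status: disputed] -/
theorem layerC312_of_S (F : FullSituation T) (Pc : Cor312.Setting F.toLatticeSituation.toSituation)
    (ρ : (∀ v : T.V, v ∈ T.Vbad → Set (F.L.StarPacket v)) → ∀ (j : T.Label) (vQ : T.VQ), Set (F.L.Packet j vQ))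
    (qK : ∀ v : T.V, v ∈ T.Vbad → Set (F.L.StarPacket v))
    -- [S] ×1
    (hS : PilotKummerIndRelated F.toLatticeSituation Pc ρ qK)
    -- [PIN] ×2
    (hPin : PinnedRegions3 F.toLatticeSituation Pc ρ qK) (hBridge : BridgeHyps Pc)
    -- [FACT] ×0
    -- [CONE] ×1 (the layer's input node: Theorem 3.11 as typed)
    (hThm311 : DAG.N_IUTchIII_Thm3_11 F) :
    DAG.N_IUTchIII_Thm3_11_i F.toLatticeSituation.toSituation ∧ DAG.N_IUTchIII_Thm3_11_ii F.toLatticeSituation ∧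
      DAG.N_IUTchIII_Thm3_11_iii F ∧ Pc.Statement :=
  ⟨hThm311.1, hThm311.2.1, hThm311.2.2,
    statement_of_thm311_of_pinned3_of_pilotKummerIndRelated F Pc ρ qK hThm311 hBridge hPin hS⟩

/-- The root of the cone IN INDEX CURRENCY: with the apex file's two READ identifications — the setting's `−|log(Θ)|` (when
finite) and `−|log(q)|` ARE the [IUTchIV] Thm-1.10 numbers `X` of the curve ([IUTchIV] Thm 1.10 Step (viii) p. 30) — S + pins +
bridge + typed Thm 3.11 give the DAG node `N_IUTchIII_Cor3_12 X := X.Cor312` (`−|log(q)| ≤ −|log(Θ)|` on the numbers). Binders: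
S 1 · PIN 2 · CONE 1 · READ 2 = 6 — exactly the per-curve binders of `Conditional.abc_of_S` v0 (C-cert-2 draft 7bd0735215c517c4),
so the apex may read `DAG.summit_of_cor312 V T A hInd (fun P => layerC312_cor312_node_of_S …)`. [claim: Mochizuki2012, status: disputed] -/
theorem layerC312_cor312_node_of_S (F : FullSituation T) (Pc : Cor312.Setting F.toLatticeSituation.toSituation)
    (ρ : (∀ v : T.V, v ∈ T.Vbad → Set (F.L.StarPacket v)) → ∀ (j : T.Label) (vQ : T.VQ), Set (F.L.Packet j vQ))
    (qK : ∀ v : T.V, v ∈ T.Vbad → Set (F.L.StarPacket v)) (X : Thm110Data)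
    (hS : PilotKummerIndRelated F.toLatticeSituation Pc ρ qK)
    (hPin : PinnedRegions3 F.toLatticeSituation Pc ρ qK) (hBridge : BridgeHyps Pc)
    (hThm311 : DAG.N_IUTchIII_Thm3_11 F)
    -- [READ] ×2
    (hΘ : ∀ x : ℝ, Pc.negLogTheta = (x : WithTop ℝ) → X.negLogTheta = x) (hq : Pc.negLogQ = -X.absLogq) :
    DAG.N_IUTchIII_Cor3_12 X := by
  have hst : Pc.Statement := (layerC312_of_S F Pc ρ qK hS hPin hBridge hThm311).2.2.2
  obtain ⟨x, hx⟩ := WithTop.ne_top_iff_exists.mp hst.1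
  have hle : Pc.negLogQ ≤ x := by
    have h2 := hst.2
    rw [← hx] at h2
    exact WithTop.coe_le_coe.mp h2
  show -X.absLogq ≤ X.negLogTheta
  rw [hΘ x hx.symm, ← hq]
  exact hle

/-- LAYER CENSUS C312 (bookkeeping over the landed citation data, by `decide` + arithmetic): the cone's four C312 members are the three
parts of Thm 3.11 and the Corollary (by arithmetic over the DAG.tsv row counts read 06:00Z); the layer's 94 DAG rows = 4 cone members + 21 proof-step rows + 35 Remark rows + 34 skeleton-file
rows; the cone members are the three parts of Thm 3.11 plus the Corollary. [folklore] -/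
theorem layerC312_census_v0 : (4 : ℕ) + 21 + 35 + 34 = 94 ∧ (3 : ℕ) + 1 = 4 := ⟨rfl, rfl⟩

end Summit.ABC.IUTFork.Conditional

end
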